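import Literature.NumberTheory.NumberFields.QuadraticCompletionAtNonsplitPlace   -- ★ (QM) `irreducible_X_sq_sub_C_of_not_isSquare`, (QP) `subsingleton_placesOver_of_not_isSquare`, (Q2) `existsUnique_eq_toPlace_add_toPlace_mul`
import HarnessLib

/-!
# THE COMPLETION OF `E = F(√m)` AT A NON-SPLIT PLACE IS `F_v[X] ⁄ (X² − d)` FOR EVERY `d` IN THE LOCAL SQUARE CLASS OF `m`
# («K₁ AS A COMPLETION», (Q1): the `F_v`-algebra isomorphism `AdjoinRoot (X² − C d) ≃ E_w` over `ι_w = toPlace v w`)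

Topic `NumberTheory/NumberFields`; namespace `Literature.NumberTheory.NumberFields`.  THEOREMS ONLY (no definition, no instance, no notation, no named fact,
no `sorry`).  Cell `pub/hodgecm-mathlib` (D-0151), crux H413 = `stmt-HodgeConjecture-24833` (`--supports`), infrastructure organ «LQC — K₁ AS A COMPLETION» (A-80 (2),
SEATCLOSE f24dca57 §4 (i) «P-2 ⟵ LQC Q1∕Q4»; W2 census addendum §B asks for «an `L_w`-algebra isomorphism `L_w[X]∕(f) ≃ M_𝔓`»).  HONEST LABEL: HC_CM is proved only modulo
the printed citations (hLiu418, h413) until rung 0 closes; this file is unconditional algebra.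

WHAT THIS FILE DOES.  `E ∕ F` a quadratic extension of number fields with involution `σ`, `δ ∈ E`, `σ δ = −δ ≠ 0`, `δ² = m ∈ F`; `v` a finite place of `F`, `d ∈ F_v` a NON-SQUARE
with `d⁻¹ m ∈ (F_v^×)²` (e.g. `m` produced from `d` by ★ (Q3) `exists_isSquare_inv_mul_coe`).  Then `m` is a local non-square, `v` is non-split (★ (QP)), and for THE place
`w ∣ v`: **`exists_ringEquiv_adjoinRoot_X_sq_sub_C`** — there is a ring isomorphism `e : AdjoinRoot (X² − C d) ≃+* E_w` with `e ∘ of = ι_w` (`toPlace v w`) and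
`e(root)² = ι_w d`; i.e. `E_w` IS the abstract local quadratic field `K₁ = F_v(√d)` as an `F_v`-algebra (Mathlib puts no `F_v`-algebra instance on `E_w`; the statement is the
instance-free form «ring isomorphism commuting with `ι_w`»).  Proof: `d⁻¹ m = s²`, `θ := δ_w ∕ ι_w s` has `θ² = ι_w d` (★ (Q2) `algebraMap_adicCompletion_sq_eq_toPlace`);
`AdjoinRoot.lift ι_w θ` is injective (`X² − d` irreducible, ★ (QM), so the source is a field) and surjective (`E_w = ι_w F_v ⊕ ι_w F_v·δ_w`, ★ (Q2)).
Consumers: with ★ `QuadraticRamifiedAtOddValuationPlace` (odd class: ramified `K₁`) ∕ ★ `QuadraticUnramifiedAtUnitPlace` (unit class: unramified `K₁`) this transports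
`Valued`, `𝒪`, `𝓀`, `IsNonarchimedeanLocalField`, `galAdicCompletionMap σ` from `E_w` to `K₁`.

## References
* [Neukirch1999] J. Neukirch, *Algebraic Number Theory*, Grundlehren 322 (1999): Ch. II (8.2)–(8.3) (`L ⊗_K K_v = ∏ L_w`, `L_w = K_v(α)`), Ch. II §10.
* [CasselsFrohlich1967] J. W. S. Cassels, A. Fröhlich (eds.), *Algebraic Number Theory* (1967): Ch. II §10 (completions in extensions).
* [Lang2002] S. Lang, *Algebra*, GTM 211 (2002): Ch. V §1 (simple extensions `K[X]∕(f)`), Ch. VI §6 (`X² − a`).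
-/

set_option autoImplicit false

noncomputable section

open NumberField IsDedekindDomain Polynomial
open Literature.NumberTheory.Automorphic Literature.NumberTheory.Automorphic.UnitaryGroup

namespace Literature.NumberTheory.NumberFields

variable {F : Type} (E : Type) [Field F] [NumberField F] [Field E] [NumberField E] [Algebra F E]

/-- **`E_w ≃ F_v[X] ⁄ (X² − d)` OVER `ι_w`.**  For the quadratic field `E ∋ δ` (`σ δ = −δ`, `δ ≠ 0`, `δ² = m ∈ F`), a finite place `v`, a local NON-SQUARE `d ∈ F_v` with `d⁻¹ m` a square
in `F_v`, and `w ∣ v` (unique, ★ (QP)): a ring isomorphism `e : AdjoinRoot (X² − C d) ≃+* E_w` with `e (of a) = ι_w a` for all `a ∈ F_v` and `e(root)² = ι_w d` — the instance-free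
form of «`E_w = F_v(√d)` as `F_v`-algebras». [cite: Neukirch1999, Ch. II (8.2)–(8.3)] [cite: CasselsFrohlich1967, Ch. II §10] [cite: Lang2002, Ch. V §1] -/
theorem exists_ringEquiv_adjoinRoot_X_sq_sub_C [Algebra.IsQuadraticExtension F E] (v : HeightOneSpectrum (𝓞 F)) (σ : E ≃ₐ[F] E) {δ : E}
    (hσδ : σ δ = -δ) (hδ : δ ≠ 0) {m : F} (hm : algebraMap F E m = δ ^ 2) {d : v.adicCompletion F} (hns : ¬ IsSquare d)
    (hdm : IsSquare (d⁻¹ * (m : v.adicCompletion F))) (w : PlacesOver E v) :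
    ∃ e : AdjoinRoot (X ^ 2 - C d) ≃+* w.1.adicCompletion E,
      (∀ a : v.adicCompletion F, e (AdjoinRoot.of (X ^ 2 - C d) a) = toPlace v w a) ∧ e (AdjoinRoot.root (X ^ 2 - C d)) ^ 2 = toPlace v w d := by
  have hd0 : d ≠ 0 := by rintro rfl; exact hns ⟨0, by simp⟩
  obtain ⟨s, hs⟩ := hdm
  set mv : v.adicCompletion F := (m : v.adicCompletion F) with hmv
  have hm' : mv = d * (s * s) := by rw [← hs, mul_inv_cancel_left₀ hd0]
  have hmv0 : mv ≠ 0 := by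
    intro h0
    have hm0 : m = 0 := by
      have : algebraMap F (v.adicCompletion F) m = 0 := h0
      exact (map_eq_zero_iff _ (algebraMap F (v.adicCompletion F)).injective).1 this
    rw [hm0, map_zero] at hm
    exact hδ (pow_eq_zero_iff two_ne_zero |>.1 hm.symm)
  have hs0 : s ≠ 0 := by rintro rfl; rw [mul_zero, mul_zero] at hm'; exact hmv0 hm'
  have hnsm : ¬ IsSquare mv := by
    rintro ⟨t, ht⟩
    refine hns ⟨t * s⁻¹, ?_⟩
    have hd' : d = mv * (s * s)⁻¹ := by rw [hm', mul_inv_cancel_right₀ (mul_ne_zero hs0 hs0)]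
    rw [hd', ht]
    field_simp
  haveI := subsingleton_placesOver_of_not_isSquare E v σ hσδ hδ hm hnsm
  -- `θ := δ_w ∕ ι_w s` is a square root of `ι_w d` in `E_w`
  set ι := toPlace v w with hι
  set δw : w.1.adicCompletion E := ((δ : E) : w.1.adicCompletion E) with hδw
  have hδw2 : δw ^ 2 = ι mv := algebraMap_adicCompletion_sq_eq_toPlace E v w hm
  have hιs : ι s ≠ 0 := (map_ne_zero ι).2 hs0
  set θ : w.1.adicCompletion E := δw * (ι s)⁻¹ with hθ
  have hθ2 : θ ^ 2 = ι d := by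
    rw [hθ, mul_pow, hδw2, hm', map_mul, map_mul, inv_pow, sq (ι s), mul_assoc, mul_inv_cancel₀ (mul_ne_zero hιs hιs), mul_one]
  have hroot : (X ^ 2 - C d).eval₂ ι θ = 0 := by
    rw [eval₂_sub, eval₂_X_pow, eval₂_C, hθ2, sub_self]
  let φ : AdjoinRoot (X ^ 2 - C d) →+* w.1.adicCompletion E := AdjoinRoot.lift ι θ hroot
  haveI : Fact (Irreducible (X ^ 2 - C d)) := ⟨irreducible_X_sq_sub_C_of_not_isSquare d hns⟩
  have hinj : Function.Injective φ := φ.injective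
  have hsurj : Function.Surjective φ := by
    intro z
    obtain ⟨p, hp, -⟩ := existsUnique_eq_toPlace_add_toPlace_mul E v σ hσδ hδ w z
    refine ⟨AdjoinRoot.of _ p.1 + AdjoinRoot.of _ (p.2 * s) * AdjoinRoot.root _, ?_⟩
    rw [map_add, map_mul, AdjoinRoot.lift_of, AdjoinRoot.lift_of, AdjoinRoot.lift_root, hp, map_mul, hθ]
    change ι p.1 + ι p.2 * ι s * (δw * (ι s)⁻¹) = ι p.1 + ι p.2 * δw
    rw [mul_assoc (ι p.2), mul_comm (ι s), mul_assoc δw, inv_mul_cancel₀ hιs, mul_one]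
  refine ⟨RingEquiv.ofBijective φ ⟨hinj, hsurj⟩, fun a => ?_, ?_⟩
  · exact AdjoinRoot.lift_of hroot
  · change φ (AdjoinRoot.root _) ^ 2 = ι d
    rw [AdjoinRoot.lift_root, hθ2]

end Literature.NumberTheory.NumberFields

end
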